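import Literature.NumberTheory.EllipticCurves.TateParameterPthPowerOfJProofs
import Literature.NumberTheory.EllipticCurves.TateParameterPrimeTorsion
import Literature.NumberTheory.EllipticCurves.TateCurve.UniformizationPoints
import Literature.NumberTheory.EllipticCurves.PAdicHeightsProofs
import Literature.NumberTheory.EllipticCurves.KuriharaNumberKimShaLengthLocalTorsionTrivial
import HarnessLib

/-!
# The Tate parameter attached to a rational `j`-invariant is NOT a `p`-th power in `ℚ_p` when the
# unit congruence fails (`p` odd), and then `E(ℚ_p)[p] = 0` at a SPLIT multiplicative prime

`Proofs` file (theorems only: no definition, no named fact) in topic `NumberTheory/EllipticCurves`; the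
NEGATIVE mirror of `TateParameterPthPowerOfJProofs` (`exists_pow_prime_eq_of_tateJ_eq_ratCast`).
Sources: J. H. Silverman, *Advanced Topics in the Arithmetic of Elliptic Curves*, GTM 151 (1994),
Thm. V.3.1 (b) (`|1/j − q| ≤ |q|²`, the tree's `norm_inv_tateJ_sub_le`), Thm. V.3.1 (d) / V.5.3 (Tate's
uniformisation `E(ℚ_p) ≅ ℚ_p^×/q^ℤ`, DISCHARGED in the tree: `TateCurve.tateUniformization_points_holds`);
J.-P. Serre, *A Course in Arithmetic*, Ch. II §3.3 (`p^k u ∈ (ℚ_p^×)^p ⟺ p ∣ k ∧ u^{p−1} ≡ 1 (mod p²)`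
for odd `p`, the tree's `Padic.exists_pow_prime_eq_iff_of_eq_pow_mul`).

THE POINT (cell `bsd-print-x11a`, PLAN v6.4 RULING 4, the «Tate road» to the `(t0)` binder of the
deep Kurihara door at the pair `320045bh1 @ 5`). For `j₀ ∈ ℚ` with `j₀⁻¹ = p^k·u`, `v_p(u) = 0`, the Tate
parameter `q` (`‖q‖ < 1`, `j(q) = j₀`) has unit part `U = q/p^k ≡ u (mod p^k)`; if `q` WERE a `p`-th power
then `p ∣ k` (so `k ≥ p ≥ 3`) and `U^{p−1} ≡ 1 (mod p²)`, whence `u^{p−1} ≡ 1 (mod p²)`. So: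

* `not_exists_pow_prime_eq_of_tateJ_eq_ratCast` — `|u^{p−1} − 1|_p > p^{−2}` ⟹ `q ∉ (ℚ_p)^p`;
* `not_exists_pow_prime_eq_of_tateJ_eq_ratCast_of_not_dvd` — `p ∤ k` ⟹ `q ∉ (ℚ_p)^p` (the valuation
  half; Kim 2022 Prop. 3.1's printed criterion);
* `natCard_localPTorsion_eq_one_of_split_of_unitCongruence_fails` /
  `natCard_localPTorsion_eq_one_of_split_of_not_dvd` — at a SPLIT multiplicative odd `p` with
  `j(E)⁻¹ = p^k·u` as above, **`#E(ℚ_p)[p] = 1`** (`E(ℚ_p)[p] ≠ 0 ⟺ q_E ∈ (ℚ_p)^p`,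
  `forall_prime_smul_eq_zero_iff_not_exists_pow_eq_tateParameter`, UNCONDITIONAL by
  `tateUniformization_points_holds`) — the `(t0)` binder `Nat.card {Q // p • Q = 0} = 1` of the Kim
  deep door from three `decide`/`norm_num`-able rational side conditions;
* `natCard_localPTorsion_eq_one_of_split_of_intCertificate` — the same with `u = a/b` displayed as
  integers: `p ∤ a`, `p ∤ b`, `p² ∤ a^{p−1} − b^{p−1}` (each a `decide`).

## References
* [SilvermanATAEC1994] J. H. Silverman, *Advanced Topics*, Thm. V.3.1 (b), (d), Lemma V.5.1, Thm. V.5.3.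
* [Serre1973] J.-P. Serre, *A Course in Arithmetic*, Ch. II §3.3.
-/

noncomputable section

open scoped Classical

namespace Literature.NumberTheory.EllipticCurves

/-! ### In `ℚ_p`: the unit part of the Tate parameter -/

section Padic

variable {p : ℕ} [hp : Fact p.Prime]

/-- **The unit part of the Tate parameter of a rational `j`** (private set-up shared by the two negative
criteria): `q ≠ 0`, `‖q‖ < 1`, `j(q) = j₀`, `j₀⁻¹ = p^k u`, `u ≠ 0`, `v_p(u) = 0` ⟹ `k ≥ 1` and `q = p^k·U`
with `U ∈ ℤ_p^×`, `‖U − u‖ ≤ p^{−k}` (`|j₀⁻¹ − q| ≤ |q|² = p^{−2k}`, Silverman V.3.1 (b)).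
[cite: SilvermanATAEC1994, Thm. V.3.1 (b) and Lemma V.5.1 (PDF pp. 395, 406)] -/
private theorem exists_unitPart_of_tateJ_eq_ratCast {q : ℚ_[p]} (hq : ‖q‖ < 1)
    {j₀ u : ℚ} {k : ℕ} (hju : j₀⁻¹ = (p : ℚ) ^ k * u) (hu0 : u ≠ 0) (hu : padicValRat p u = 0)
    (hqj : tateJ q = (j₀ : ℚ_[p])) :
    1 ≤ k ∧ ∃ Uz : ℤ_[p], IsUnit Uz ∧ q = (p : ℚ_[p]) ^ k * (Uz : ℚ_[p]) ∧
      ‖(Uz : ℚ_[p]) - (u : ℚ_[p])‖ ≤ (p : ℝ) ^ (-(k : ℤ)) := by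
  have hp1 : (1 : ℝ) < p := by exact_mod_cast hp.out.one_lt
  have hpQ : (p : ℚ_[p]) ≠ 0 := by exact_mod_cast hp.out.ne_zero
  -- `‖u‖ = 1`
  have hnu : ‖((u : ℚ) : ℚ_[p])‖ = 1 := by
    rw [Padic.eq_padicNorm, padicNorm.eq_zpow_of_nonzero hu0, hu, neg_zero, zpow_zero, Rat.cast_one]
  -- `J⁻¹ = p^k u` in `ℚ_p`
  have hJ : (tateJ q)⁻¹ = (p : ℚ_[p]) ^ k * (u : ℚ_[p]) := by
    rw [hqj, ← Rat.cast_inv, hju]; push_cast; ring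
  -- `‖q‖ = p^{-k}`, hence `1 ≤ k`
  have hqn : ‖q‖ = (p : ℝ) ^ (-(k : ℤ)) := by
    have h := norm_tateJ_eq hq
    have h' : ‖(tateJ q)⁻¹‖ = ‖q‖ := by rw [norm_inv, h, inv_inv]
    rw [← h', hJ, norm_mul, Padic.norm_p_pow, hnu, mul_one]
  have hk1 : 1 ≤ k := by
    by_contra h0
    have hk : k = 0 := by omega
    rw [hk, Nat.cast_zero, neg_zero, zpow_zero] at hqn
    exact (lt_irrefl _) (hqn ▸ hq)
  -- the unit part `U = q / p^k`: `‖U − u‖ ≤ p^{-k}`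
  set U : ℚ_[p] := q * ((p : ℚ_[p]) ^ k)⁻¹ with hUdef
  have hqU : q = (p : ℚ_[p]) ^ k * U := by rw [hUdef]; field_simp
  have hUu : ‖U - (u : ℚ_[p])‖ ≤ (p : ℝ) ^ (-(k : ℤ)) := by
    have hUu' : U - (u : ℚ_[p]) = (q - (tateJ q)⁻¹) * ((p : ℚ_[p]) ^ k)⁻¹ := by
      rw [hJ, hUdef]; field_simp
    rw [hUu', norm_mul, norm_inv, Padic.norm_p_pow, norm_sub_rev]
    calc ‖(tateJ q)⁻¹ - q‖ * ((p : ℝ) ^ (-(k : ℤ)))⁻¹ ≤ ‖q‖ * ‖q‖ * ((p : ℝ) ^ (-(k : ℤ)))⁻¹ := by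
          gcongr
          exact norm_inv_tateJ_sub_le hq
      _ = (p : ℝ) ^ (-(k : ℤ)) := by
          rw [hqn]; field_simp
  have hltk : (p : ℝ) ^ (-(k : ℤ)) < 1 := zpow_lt_one_of_neg₀ hp1 (by omega)
  have hU1 : ‖U‖ = 1 := by
    have hlt : ‖U - (u : ℚ_[p])‖ < ‖((u : ℚ) : ℚ_[p])‖ := by rw [hnu]; exact hUu.trans_lt hltk
    have h := IsUltrametricDist.norm_add_eq_max_of_norm_ne_norm hlt.ne
    rw [sub_add_cancel, max_eq_right hlt.le, hnu] at h
    exact h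
  refine ⟨hk1, ⟨U, hU1.le⟩, PadicInt.isUnit_iff.mpr (by rw [PadicInt.norm_def]; exact hU1), hqU, hUu⟩

/-- **NEGATIVE `j`-criterion, unit-congruence branch** (`p` odd): `q ∈ ℚ_p`, `q ≠ 0`, `‖q‖ < 1`,
`j(q) = j₀ ∈ ℚ`, `j₀⁻¹ = p^k·u`, `u ≠ 0`, `v_p(u) = 0` and `|u^{p−1} − 1|_p > p^{−2}` ⟹ `q` is NOT a `p`-th
power in `ℚ_p`. If `q = x^p` then `p ∣ k` and `U^{p−1} ≡ 1 (mod p²)` for the unit part `U = q/p^k`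
(Serre II §3.3, `Padic.exists_pow_prime_eq_iff_of_eq_pow_mul`); `k ≥ p ≥ 3` and `‖U − u‖ ≤ p^{−k}`
(Silverman V.3.1 (b)) transfer the congruence to `u` — contradiction.
[cite: SilvermanATAEC1994, Thm. V.3.1 (b) and Lemma V.5.1 (PDF pp. 395, 406)] [cite: Serre1973, Ch. II §3.3] -/
theorem not_exists_pow_prime_eq_of_tateJ_eq_ratCast (hp2 : p ≠ 2) {q : ℚ_[p]}
    (hq : ‖q‖ < 1) {j₀ u : ℚ} {k : ℕ} (hju : j₀⁻¹ = (p : ℚ) ^ k * u) (hu0 : u ≠ 0)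
    (hu : padicValRat p u = 0) (hunit : (p : ℚ) ^ (-2 : ℤ) < padicNorm p (u ^ (p - 1) - 1))
    (hqj : tateJ q = (j₀ : ℚ_[p])) : ¬ ∃ x : ℚ_[p], x ^ p = q := by
  have hp1 : (1 : ℝ) < p := by exact_mod_cast hp.out.one_lt
  obtain ⟨hk1, Uz, hUzunit, hqU, hUu⟩ := exists_unitPart_of_tateJ_eq_ratCast hq hju hu0 hu hqj
  intro hx
  obtain ⟨hpk, hdvd⟩ := (Padic.exists_pow_prime_eq_iff_of_eq_pow_mul hp2 hUzunit hqU).mp hx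
  have hk2 : 2 ≤ k := le_trans hp.out.two_le (Nat.le_of_dvd (by omega) hpk)
  have hnu : ‖((u : ℚ) : ℚ_[p])‖ = 1 := by
    rw [Padic.eq_padicNorm, padicNorm.eq_zpow_of_nonzero hu0, hu, neg_zero, zpow_zero, Rat.cast_one]
  set uz : ℤ_[p] := ⟨((u : ℚ) : ℚ_[p]), hnu.le⟩ with huz
  -- `‖U − u‖ ≤ p^{−2}`
  have hUu2 : ‖(Uz : ℚ_[p]) - (u : ℚ_[p])‖ ≤ (p : ℝ) ^ (-(2 : ℤ)) :=
    hUu.trans (zpow_le_zpow_right₀ hp1.le (by omega))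
  -- `‖U^{p−1} − 1‖ ≤ p^{−2}` from the divisibility
  have hA : ‖Uz ^ (p - 1) - 1‖ ≤ (p : ℝ) ^ (-(2 : ℤ)) :=
    (PadicInt.norm_le_pow_iff_mem_span_pow _ 2).mpr (Ideal.mem_span_singleton.mpr hdvd)
  -- `‖U^{p−1} − u^{p−1}‖ ≤ ‖U − u‖ ≤ p^{−2}`
  have hB : ‖Uz ^ (p - 1) - uz ^ (p - 1)‖ ≤ (p : ℝ) ^ (-(2 : ℤ)) := by
    obtain ⟨c, hc⟩ := sub_dvd_pow_sub_pow Uz uz (p - 1)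
    rw [hc, norm_mul]
    calc ‖Uz - uz‖ * ‖c‖ ≤ ‖Uz - uz‖ * 1 := by gcongr; exact PadicInt.norm_le_one c
      _ ≤ (p : ℝ) ^ (-(2 : ℤ)) := by
          rw [mul_one, PadicInt.norm_def, PadicInt.coe_sub]
          exact hUu2
  -- hence `‖u^{p−1} − 1‖ ≤ p^{−2}`, contradicting `hunit`
  have hC : ‖uz ^ (p - 1) - 1‖ ≤ (p : ℝ) ^ (-(2 : ℤ)) := by
    have he : uz ^ (p - 1) - 1 = (Uz ^ (p - 1) - 1) + (uz ^ (p - 1) - Uz ^ (p - 1)) := by ring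
    rw [he]
    refine (IsUltrametricDist.norm_add_le_max _ _).trans (max_le hA ?_)
    rw [norm_sub_rev]
    exact hB
  have hC' : padicNorm p (u ^ (p - 1) - 1) ≤ (p : ℚ) ^ (-2 : ℤ) := by
    rw [PadicInt.norm_def, PadicInt.coe_sub, PadicInt.coe_pow, PadicInt.coe_one, huz] at hC
    change ‖((u : ℚ) : ℚ_[p]) ^ (p - 1) - 1‖ ≤ _ at hC
    have hcast : ((u : ℚ) : ℚ_[p]) ^ (p - 1) - 1 = (((u ^ (p - 1) - 1 : ℚ)) : ℚ_[p]) := by push_cast; ring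
    rw [hcast, Padic.eq_padicNorm] at hC
    have h' : ((padicNorm p (u ^ (p - 1) - 1) : ℚ) : ℝ) ≤ (((p : ℚ) ^ (-2 : ℤ) : ℚ) : ℝ) := by
      simpa only [Rat.cast_zpow, Rat.cast_natCast] using hC
    exact Rat.cast_le.mp h'
  exact absurd hunit (not_lt.mpr hC')

/-- **NEGATIVE `j`-criterion, valuation branch** (`p` odd): `j₀⁻¹ = p^k·u` with `v_p(u) = 0` and
`p ∤ k` ⟹ the Tate parameter `q` (`‖q‖ < 1`, `j(q) = j₀`) is NOT a `p`-th power in `ℚ_p` — the printed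
half of Kim's criterion (`p ∤ ord_p q_E`). [cite: SilvermanATAEC1994, Thm. V.3.1 (b) (PDF p. 395)]
[cite: Serre1973, Ch. II §3.3] -/
theorem not_exists_pow_prime_eq_of_tateJ_eq_ratCast_of_not_dvd (hp2 : p ≠ 2) {q : ℚ_[p]}
    (hq : ‖q‖ < 1) {j₀ u : ℚ} {k : ℕ} (hju : j₀⁻¹ = (p : ℚ) ^ k * u) (hu0 : u ≠ 0)
    (hu : padicValRat p u = 0) (hpk : ¬ p ∣ k) (hqj : tateJ q = (j₀ : ℚ_[p])) :
    ¬ ∃ x : ℚ_[p], x ^ p = q := by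
  obtain ⟨-, Uz, hUzunit, hqU, -⟩ := exists_unitPart_of_tateJ_eq_ratCast hq hju hu0 hu hqj
  intro hx
  exact hpk ((Padic.exists_pow_prime_eq_iff_of_eq_pow_mul hp2 hUzunit hqU).mp hx).1

end Padic

/-! ### The `(t0)` binder `#E(ℚ_p)[p] = 1` on the split multiplicative locus — unconditional -/

section LocalTorsion

variable {p : ℕ} [hp : Fact p.Prime]

/-- **`#E(ℚ_p)[p] = 1` at a SPLIT multiplicative odd `p` when the unit congruence fails**: `W/ℚ`
elliptic, split multiplicative at `p`, `j(W)⁻¹ = p^k·u` with `u ≠ 0`, `v_p(u) = 0` and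
`|u^{p−1} − 1|_p > p^{−2}` ⟹ `Nat.card {Q ∈ E(ℚ_p) // p • Q = 0} = 1`. Tate's uniformisation
(`nonempty_tateParameterData_iff_holds`: a Tate parameter `q_E` with `j(q_E) = j(W)` exists at a split
prime; `tateUniformization_points_holds`: `E(ℚ_p) ≅ ℚ_p^×/q_E^ℤ`, so `E(ℚ_p)[p] ≠ 0 ⟺ q_E ∈ (ℚ_p)^p`,
`forall_prime_smul_eq_zero_iff_not_exists_pow_eq_tateParameter`) and the negative `j`-criterion. For
`320045bh1 @ 5`: `j⁻¹ = 5⁵·u`, `u ≡ 17`, `u⁴ ≡ 21 ≢ 1 (mod 25)`.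
[cite: SilvermanATAEC1994, Thm. V.3.1 (b), (d) and Thm. V.5.3] [cite: Serre1973, Ch. II §3.3] -/
theorem natCard_localPTorsion_eq_one_of_split_of_unitCongruence_fails (hp2 : p ≠ 2)
    (W : WeierstrassCurve ℚ) [W.IsElliptic] (hsplit : W.HasSplitMultiplicativeReductionAtPrime p)
    {u : ℚ} {k : ℕ} (hju : W.j⁻¹ = (p : ℚ) ^ k * u) (hu0 : u ≠ 0) (hu : padicValRat p u = 0)
    (hunit : (p : ℚ) ^ (-2 : ℤ) < padicNorm p (u ^ (p - 1) - 1)) :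
    Nat.card {Q : (W.baseChange ℚ_[p]).toAffine.Point // (p : ℕ) • Q = 0} = 1 := by
  obtain ⟨D⟩ := (WeierstrassCurve.nonempty_tateParameterData_iff_holds (W := W) (p := p)).mpr hsplit
  have hnot : ¬ ∃ x : ℚ_[p], x ^ p = D.q :=
    not_exists_pow_prime_eq_of_tateJ_eq_ratCast hp2 D.norm_q_lt_one hju hu0 hu hunit D.tateJ_eq
  have hall := (forall_prime_smul_eq_zero_iff_not_exists_pow_eq_tateParameter W
    TateCurve.tateUniformization_points_holds hp2 D).mpr hnot
  exact (natCard_localPTorsion_eq_one_iff W p).mpr fun P hP => hall P (by rwa [natCast_zsmul] at hP)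

/-- **`#E(ℚ_p)[p] = 1` at a SPLIT multiplicative odd `p` when `p ∤ ord_p(1/j)`**: `j(W)⁻¹ = p^k·u`,
`u ≠ 0`, `v_p(u) = 0`, `p ∤ k` ⟹ `Nat.card {Q ∈ E(ℚ_p) // p • Q = 0} = 1` (Tate: `v_p(q_E) = −v_p(j) = k`,
and `q_E ∈ (ℚ_p)^p` forces `p ∣ v_p(q_E)`). Unconditional, as above.
[cite: SilvermanATAEC1994, Thm. V.3.1 (b), (d) and Thm. V.5.3] [cite: Serre1973, Ch. II §3.3] -/
theorem natCard_localPTorsion_eq_one_of_split_of_not_dvd (hp2 : p ≠ 2)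
    (W : WeierstrassCurve ℚ) [W.IsElliptic] (hsplit : W.HasSplitMultiplicativeReductionAtPrime p)
    {u : ℚ} {k : ℕ} (hju : W.j⁻¹ = (p : ℚ) ^ k * u) (hu0 : u ≠ 0) (hu : padicValRat p u = 0)
    (hpk : ¬ p ∣ k) :
    Nat.card {Q : (W.baseChange ℚ_[p]).toAffine.Point // (p : ℕ) • Q = 0} = 1 := by
  obtain ⟨D⟩ := (WeierstrassCurve.nonempty_tateParameterData_iff_holds (W := W) (p := p)).mpr hsplit
  have hnot : ¬ ∃ x : ℚ_[p], x ^ p = D.q :=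
    not_exists_pow_prime_eq_of_tateJ_eq_ratCast_of_not_dvd hp2 D.norm_q_lt_one hju hu0 hu hpk D.tateJ_eq
  have hall := (forall_prime_smul_eq_zero_iff_not_exists_pow_eq_tateParameter W
    TateCurve.tateUniformization_points_holds hp2 D).mpr hnot
  exact (natCard_localPTorsion_eq_one_iff W p).mpr fun P hP => hall P (by rwa [natCast_zsmul] at hP)

/-- **Integer certificate form of the Tate road** (the shape a record DISPLAYS and `decide` checks):
split multiplicative odd `p`, `j(W)⁻¹ = p^k·(a/b)` with `p ∤ a`, `p ∤ b` and `p² ∤ a^{p−1} − b^{p−1}`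
⟹ `#E(ℚ_p)[p] = 1` (`v_p(a/b) = 0` and `|(a/b)^{p−1} − 1|_p = |a^{p−1} − b^{p−1}|_p ≥ p^{−1} > p^{−2}`).
[cite: SilvermanATAEC1994, Thm. V.3.1 (b), (d) and Thm. V.5.3] [cite: Serre1973, Ch. II §3.3] -/
theorem natCard_localPTorsion_eq_one_of_split_of_intCertificate (hp2 : p ≠ 2)
    (W : WeierstrassCurve ℚ) [W.IsElliptic] (hsplit : W.HasSplitMultiplicativeReductionAtPrime p)
    {a b : ℤ} {k : ℕ} (hju : W.j⁻¹ = (p : ℚ) ^ k * ((a : ℚ) / (b : ℚ))) (ha : ¬ (p : ℤ) ∣ a)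
    (hb : ¬ (p : ℤ) ∣ b) (hunit : ¬ (p : ℤ) ^ 2 ∣ a ^ (p - 1) - b ^ (p - 1)) :
    Nat.card {Q : (W.baseChange ℚ_[p]).toAffine.Point // (p : ℕ) • Q = 0} = 1 := by
  have hP : Prime (p : ℤ) := Nat.prime_iff_prime_int.mp hp.out
  have ha0 : a ≠ 0 := fun h ↦ ha (h ▸ dvd_zero _)
  have hb0 : b ≠ 0 := fun h ↦ hb (h ▸ dvd_zero _)
  have haQ : (a : ℚ) ≠ 0 := Int.cast_ne_zero.mpr ha0
  have hbQ : (b : ℚ) ≠ 0 := Int.cast_ne_zero.mpr hb0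
  have hu0 : (a : ℚ) / (b : ℚ) ≠ 0 := div_ne_zero haQ hbQ
  have hu : padicValRat p ((a : ℚ) / (b : ℚ)) = 0 := by
    rw [padicValRat.div haQ hbQ, padicValRat.of_int, padicValRat.of_int,
      padicValInt.eq_zero_of_not_dvd ha, padicValInt.eq_zero_of_not_dvd hb]
    simp
  refine natCard_localPTorsion_eq_one_of_split_of_unitCongruence_fails hp2 W hsplit hju hu0 hu ?_
  set m : ℤ := a ^ (p - 1) - b ^ (p - 1) with hm
  have hm0 : m ≠ 0 := fun h ↦ hunit (by rw [h]; exact dvd_zero _)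
  have hbpow : ¬ (p : ℤ) ∣ b ^ (p - 1) := fun h ↦ hb (hP.dvd_of_dvd_pow h)
  have hval : padicValInt p m ≤ 1 := by
    by_contra hlt
    exact hunit ((padicValInt_dvd_iff 2 m).mpr (Or.inr (by omega)))
  have heq : ((a : ℚ) / (b : ℚ)) ^ (p - 1) - 1 = (m : ℚ) / ((b ^ (p - 1) : ℤ) : ℚ) := by
    rw [hm, div_pow]
    push_cast
    rw [div_sub_one (pow_ne_zero _ hbQ)]
  rw [heq, padicNorm.div, (padicNorm.int_eq_one_iff _).mpr hbpow, div_one,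
    padicNorm.eq_zpow_of_nonzero (Int.cast_ne_zero.mpr hm0), padicValRat.of_int]
  exact zpow_lt_zpow_right₀ (by exact_mod_cast hp.out.one_lt) (by omega)

end LocalTorsion

end Literature.NumberTheory.EllipticCurves

end
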